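import Literature.AlgebraicGeometry.Resolution.GeneralizedStabilityTrustBase
import Literature.AlgebraicGeometry.Resolution.OstrowskiResidueCharZero
import HarnessLib

/-!
# The generalized stability theorem for `k(x, y)`: trust base (Kuhlmann 2010, Thm. 1.1)

Topic: `Literature/AlgebraicGeometry/Resolution` (valued function fields). Assembly, for the named
fact `Kuhlmann2010StabilityRational` (`GeneralizedStability.lean`) = F.-V. Kuhlmann, *Elimination
of ramification I: The generalized stability theorem*, Trans. AMS 362 (2010) 5697–5727 =
arXiv:1003.5678, **Thm. 1.1** for `F = k(x₁, …, x_r, y₁, …, y_s)` generated over the TRIVIALLY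
valued `k` by a standard valuation transcendence basis, of what the directory now proves along the
printed proof (§5): Lemma 5.1 (`Kuhlmann2010StabilityRational.of_valueTranscendental`), Lemma 5.2
with Cor. 2.25 (`Kuhlmann2010StabilityValueTranscendental.of_descent_of_rankOne'`,
`Kuhlmann2010DefectlessDescent_holds`), Lemmas 5.3–5.4, and the proof of (R4) on pp. 18–20
(Ostrowski's lemma, Thm. 2.14, Lemma 2.2, Prop. 2.18, Lemma 2.27, Prop. 3.1, Lemma 5.5, Prop. 4.5),
everything PROVED except the three normal forms of §4 behind Cor. 4.2:

* `Kuhlmann2010Prop46ValueIndex` — Prop. 4.6 (mixed characteristic, value-transcendental case);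
* `Kuhlmann2010GaloisResidueDegreeEqChar` — Prop. 4.12 (equal characteristic,
  residue-transcendental case);
* `Kuhlmann2010Prop413ResidueDegree` — Prop. 4.13 (mixed characteristic, residue-transcendental
  case).

## Content (PROVED)

* `Kuhlmann2010StabilityRational.of_leaves` — `Kuhlmann2010StabilityRational` from these three
  facts (so that `Kuhlmann2010StabilityRational_holds` is a one-line application once they are
  proved).
* `Kuhlmann2010StabilityRational.of_charZero` — the case `char k = 0` of
  `Kuhlmann2010StabilityRational`, outright: the residue field of `F°` is a `k`-algebra, hence of
  characteristic `0`, and "every valued field `(K,v)` with `char Kv = 0` is a defectless field"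
  (Cor. 2.12, `Kuhlmann2010DefectlessOfResidueCharZero_holds`).

## Remark (scope of the leaves)

Over a trivially valued ground field `k ⊆ F°` the valued field `(F, F°)` and every valued field met
in the reductions of §5 (subfields, `K(t)`, algebraic closures, coarsenings `w` of `v` and the
residue fields `Fw` valued by `w̄`) have EQUAL characteristic `char F = char Fv = char k`: for
`char k = 0` the theorem is Cor. 2.12 (`Kuhlmann2010StabilityRational.of_charZero`), and for
`char k = p` only the equal-characteristic normal forms (Prop. 4.5, proved in
`HenselizedRationalArtinSchreier.lean`, and Prop. 4.12) are met. The mixed-characteristic leaves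
Prop. 4.6 and Prop. 4.13 enter `Kuhlmann2010StabilityRational.of_leaves` only through the
generality of the intermediate named facts of the decomposition
(`Kuhlmann2010StabilityValueTranscendental`, `Kuhlmann2010HenselizedRationalImmediateExt`,
`Kuhlmann2010GaloisDegreePDefectless`, …), which are stated for ground fields of arbitrary
characteristic.

## Sources

* F.-V. Kuhlmann, *Elimination of ramification I: The generalized stability theorem*, Trans.
  Amer. Math. Soc. 362 (2010) 5697–5727 = arXiv:1003.5678: Thm. 1.1, Cor. 2.12 (p. 6), §4
  (Cor. 4.2, Props. 4.5, 4.6, 4.12, 4.13), §5 (Lemmas 5.1–5.5 and the proof of Thm. 1.1,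
  pp. 18–20). [Kuhlmann2010]
-/

noncomputable section

open IsLocalRing

namespace Literature.AlgebraicGeometry.Resolution

universe u

/-- **Kuhlmann 2010, Thm. 1.1 for `k(x, y)` over a trivially valued `k`, from the three normal
forms of §4** (Prop. 4.6: `Kuhlmann2010Prop46ValueIndex`; Prop. 4.12:
`Kuhlmann2010GaloisResidueDegreeEqChar`; Prop. 4.13: `Kuhlmann2010Prop413ResidueDegree`):
Lemma 5.1 (`Kuhlmann2010StabilityRational.of_valueTranscendental`) composed with Lemma 5.2 /
Cor. 2.25 / Lemmas 5.3–5.4 (`Kuhlmann2010StabilityValueTranscendental.of_descent_of_rankOne'`,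
`Kuhlmann2010DefectlessDescent_holds`) and the two rank-one cases of (R4)
(`Kuhlmann2010StabilityRankOneValueTranscendental.of_ostrowski_of_immediateExt` with
`Kuhlmann2010HenselizedRationalImmediateExt.of_prop46`;
`Kuhlmann2010StabilityRankOneResidueTranscendental.of_ostrowski_of_galois` with
`Kuhlmann2010GaloisDegreePDefectless.of_residueDegree`), Ostrowski's lemma and the reduction to
tame towers being proved (`Kuhlmann2010OstrowskiLemma_holds`,
`Kuhlmann2010TameTowerReduction_holds`). PROVED.
[cite: Kuhlmann2010, Thm. 1.1 with Section 5 (Lemmas 5.1–5.5, pp. 18–20) and Cor. 4.2] -/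
theorem Kuhlmann2010StabilityRational.of_leaves (h46 : Kuhlmann2010Prop46ValueIndex.{u})
    (h412 : Kuhlmann2010GaloisResidueDegreeEqChar.{u})
    (h413 : Kuhlmann2010Prop413ResidueDegree.{u}) : Kuhlmann2010StabilityRational.{u} :=
  Kuhlmann2010StabilityRational.of_valueTranscendental
    (Kuhlmann2010StabilityValueTranscendental.of_descent_of_rankOne'
      Kuhlmann2010DefectlessDescent_holds
      (Kuhlmann2010StabilityRankOneValueTranscendental.of_ostrowski_of_immediateExt
        Kuhlmann2010OstrowskiLemma_holds (Kuhlmann2010HenselizedRationalImmediateExt.of_prop46 h46))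
      (Kuhlmann2010StabilityRankOneResidueTranscendental.of_ostrowski_of_galois
        Kuhlmann2010OstrowskiLemma_holds Kuhlmann2010TameTowerReduction_holds
        (Kuhlmann2010GaloisDegreePDefectless.of_residueDegree h412 h413)))

/-- **Kuhlmann 2010, Thm. 1.1 for `k(x, y)` over a trivially valued `k` of characteristic `0`**,
outright: `k ⊆ F°` maps to the residue field `Fv` of `F°`, so `char Fv = 0`, and "every valued
field `(K,v)` with `char Kv = 0` is a defectless field" (Cor. 2.12,
`Kuhlmann2010DefectlessOfResidueCharZero_holds`, from the Lemma of Ostrowski). The hypotheses on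
the generators are not needed for this case. PROVED. [cite: Kuhlmann2010, Thm. 1.1 and Cor. 2.12] -/
theorem Kuhlmann2010StabilityRational.of_charZero (k K : Type u) [Field k] [Field K] [Algebra k K]
    [CharZero k] (O : ValuationSubring K) [Algebra k O] [IsScalarTower k O K] :
    IsDefectlessField K O := by
  letI : Algebra k (ResidueField O) := ((residue O).comp (algebraMap k O)).toAlgebra
  haveI : CharZero (ResidueField O) :=
    charZero_of_injective_algebraMap ((residue O).comp (algebraMap k O)).injective
  exact Kuhlmann2010DefectlessOfResidueCharZero_holds K O inferInstance

end Literature.AlgebraicGeometry.Resolution
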